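import Literature.NumberTheory.Transcendental.KaehlerHodgeDolbeaultHarmonicCounterexample
import Mathlib.Algebra.Polynomial.Roots
import Mathlib.LinearAlgebra.Dimension.Finite
import HarnessLib

/-!
# The named fact `finite_dolbeaultHarmonicForms` is false as stated (the `{id, conj}`-rigged torus)

Theorems-only companion of `Literature/NumberTheory/Transcendental/KaehlerHodge.lean` (C12) and of
`KaehlerHodgeComplexAtlasFact.lean` (the corrected statement
`Literature.NumberTheory.Transcendental.finite_dolbeaultHarmonicForms_of_isManifold`).

`KaehlerHodge.lean` records the finite-dimensionality of the spaces `ℋ^{p,q}` of `∂̄`-harmonic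
`(p,q)`-forms of a compact Hermitian manifold (C. Voisin, *Hodge Theory and Complex Algebraic
Geometry I* (2002), Cor. 5.20: `Δ_∂̄` is elliptic; Thm. 5.22: the kernel of an elliptic operator
on a compact manifold is finite-dimensional, "which we will use without proof (see Demailly
1996)"; Cor. 5.25 (b) and Remark 5.26: "There is no easy proof"; D. Huybrechts, *Complex
Geometry* (2005), §3.2; Griffiths–Harris (1978), p. 84) as the named fact
`Literature.NumberTheory.Transcendental.finite_dolbeaultHarmonicForms g o`, a `def … : Prop` written
in `section Hermitian` after `variable … [IsManifold 𝓘(ℂ, E) ω M] [IsManifold 𝓘(ℝ, E) ∞ M] (g …) (o …)`.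

**Finding (review of the prove-seat's triage, D-0026).** The body of the `def` mentions `g` (hence
the real tangent bundle and `[IsManifold 𝓘(ℝ, E) ∞ M]`) but nothing in it uses the *complex*-manifold
instance, so Lean did not abstract it: `#check @finite_dolbeaultHarmonicForms` lists
`{E} [NormedAddCommGroup E] [NormedSpace ℂ E] {M} [TopologicalSpace M] [ChartedSpace E M] {k m : ℕ}
[FiniteDimensional ℂ E] {n : ℕ} [Fact (finrank ℝ E = n)] [IsManifold 𝓘(ℝ, E) ∞ M] (g) (o)` as its
only binders — the defect already recorded for its siblings `isDolbeaultHarmonic_iff`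
(`KaehlerHodgeDolbeaultHarmonicCounterexample.lean`), `cl2Inner_dolbeaultBar_left`,
`dolbeaultHarmonicForms_conj`, … The fact is therefore stated for every compact *real* `C^∞`
manifold whose charts take values in `E`, with the "complex structure" `tangentJ` = multiplication by
`i` in the coordinates of the *preferred chart* `chartAt x`, which is not a tensor unless the
transition maps are holomorphic; `IsOfType`, `∂̄`, `∂̄* = -⋆∂⋆` and `Δ_∂̄` are then read chart-wise and
`mextDeriv` feeds Mathlib's junk value `0` wherever a chart representative fails to be
differentiable. This file proves that in that generality the fact is **false**
(`TorusConjAtlas.not_finite_dolbeaultHarmonicForms_torus`): on the `{id, conj}`-rigged torus of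
`KaehlerHodgeDolbeaultHarmonicCounterexample.lean` the space `ℋ^{1,1}` is **infinite-dimensional**. It
records the universal closure over exactly the binders the fact elaborates with
(`not_finite_dolbeaultHarmonicForms`; also the surface-level closure
`not_forall_finite_dolbeaultHarmonicForms`), hence that no closed proof
`finite_dolbeaultHarmonicForms_holds` can exist. The intended statement carries
`[IsManifold 𝓘(ℂ, E) ω M]` as a binder of the `def` itself: it is the corrected named fact
`finite_dolbeaultHarmonicForms_of_isManifold` (`KaehlerHodgeComplexAtlasFact.lean`, same body,
definitionally the old `Prop` at a complex manifold), a genuine theorem of the elliptic theory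
(Voisin, Thm. 5.22), reduced in the tree to Warner's compactness theorem 6.6 for `Δ_∂̄` on `A^{p,q}`
(`finite_dolbeaultHarmonicForms_of_compactness`, `KaehlerHodgeEllipticReductionProofs.lean`) and not
discharged.

## The counterexample (`namespace TorusConjAtlas`, continued)

Setting of `KaehlerHodgeDolbeaultHarmonicCounterexample.lean`: `M = T² = (ℝ/ℤ)²` (compact Hausdorff),
charted on `E = ℂ` (`n = 2`) by local inverses of the covering map followed by the frame map
`L_q ∈ {id, conj}` (`conj` exactly at the points with rational first coordinate, a dense and
co-dense set) — a real-analytic, non-holomorphic atlas (`chartedSpaceT`, `isManifoldT`); the flat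
metric `metric` (a `C^∞` metric, Hermitian: `isHermitian`); the orientation family `orient` with
smooth volume form (`isSmoothForm_riemannianVolumeForm`). That file shows that the smooth top-degree
form `(F(x) · vol) ⊗ 1`, `F' = sin³(2π ·)`, is `∂̄`-harmonic of type `(1,1)`. Here:

* **The family** `α_i = ((F(x) + 1)^{i+1} · vol) ⊗ 1`, `i ∈ ℕ` (`alphai`), smooth, of type `(1,1)`.
  With `|F| ≤ 2/3` (`abs_F_le`) one has `F + 1 > 0`, so the derivative
  `S_i = (i+1)(F+1)^i sin³(2π ·)` of `(F + 1)^{i+1}` (`Si`, `hasDerivAt_Fpow`) vanishes exactly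
  where `sin(2π ·)` does, to second order: `|S_i(t)| ≤ (i+1) 2^i (2π)² |t - t₀|²` near such `t₀`
  (`abs_Si_re_le`). Exactly as for `i = 0`: `⋆α_i = (F+1)^{i+1}`, `∂⋆α_i = ½ S_i dz`,
  `∂̄*α_i = β_i := (i ε S_i / 2) dz` (`dolbeaultBarAdjoint_alphai`), whose chart representatives
  evaluated on `1` are `i ρ(Re y) S_i(Re y) / 2` (`ρ = ∓1` on rationals/irrationals), discontinuous
  where `S_i ≠ 0` (junk derivative `0`) and with honest derivative `0` where `sin(2π Re y) = 0`; so
  `dβ_i = 0` (`mextDeriv_betai`), `Δ_∂̄ α_i = ∂̄β_i = 0` (`dolbeaultLaplacian_alphai`), and every `α_i`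
  is `∂̄`-harmonic of type `(1,1)` (`isDolbeaultHarmonic_alphai`), i.e. lies in
  `ℋ^{1,1} = dolbeaultHarmonicForms orient 1 1 h` (`k = 2`, `m = 0`).
* **Linear independence** (`linearIndependent_alphai`): `α_i` evaluated at `proj t` on `(1, i)` is
  `ε (F(t) + 1)^{i+1}`; a vanishing finite combination `∑ c_i α_i = 0` makes the complex polynomial
  `∑ c_i X^{i+1}` vanish on the infinite set `F(ℝ) + 1 ⊇ [F(0), F(½)] + 1` (`F(0) = -1/(3π) <
  1/(3π) = F(½)`, intermediate values), hence it is zero (`Polynomial.eq_zero_of_infinite_isRoot`).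
* **Assembly**: a `ℂ`-module containing an infinite linearly independent family is not
  `Module.Finite` (`Module.Finite.not_linearIndependent_of_infinite`), so the instance the fact
  asserts for `(T², metric, orient)`, `p = q = 1`, `h : 2 + 0 = 2`, is contradictory.

Every identity used holds at every point; the only junk values are the ones the fact itself feeds
into `Δ_∂̄` by quantifying over this real-smooth, non-holomorphic atlas. No definition of
`KaehlerHodge.lean` is touched and no named fact is introduced.

## References

* C. Voisin, *Hodge Theory and Complex Algebraic Geometry I*, Cambridge Studies in Advanced
  Mathematics 76 (2002), §5.2.1 Def. 5.17, Cor. 5.20, §5.2.3 Thm. 5.22, §5.3.1 Thm. 5.24,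
  Cor. 5.25, Remark 5.26 — the intended (compact complex manifold) statement.
  [cite: Voisin2002, Thm. 5.22 and Cor. 5.25]
* D. Huybrechts, *Complex Geometry. An Introduction*, Universitext (2005), §3.2 (`ℋ^{p,q}_∂̄(X, g)`
  finite-dimensional, Thm. 3.2.8). [cite: Huybrechts2005, §3.2]
-/

noncomputable section

open scoped Manifold ContDiff Topology ComplexConjugate InnerProductSpace Real Polynomial
open Bundle Module Set Filter ContinuousAlternatingMap
open Literature.Geometry.Kaehler

namespace Literature.NumberTheory.Transcendental

namespace TorusConjAtlas

/-! ### Bounds on `F` -/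

/-- `|F| ≤ 2/3` (`F = -cos(2π·)/(2π) + cos³(2π·)/(6π)`, so `|F| ≤ 1/(2π) + 1/(6π) ≤ 1/2 + 1/6`).
[folklore] -/
theorem abs_F_le (t : ℝ) : |TorusRough.F t| ≤ 2 / 3 := by
  have hπ2 : (2 : ℝ) ≤ π := Real.two_le_pi
  have hc : |Real.cos (2 * π * t)| ≤ 1 := Real.abs_cos_le_one _
  have h2 : |(-Real.cos (2 * π * t) / (2 * π))| ≤ 1 / 2 := by
    rw [abs_div, abs_neg, abs_of_pos (by positivity : (0 : ℝ) < 2 * π), div_le_iff₀ (by positivity)]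
    nlinarith
  have h3 : |Real.cos (2 * π * t) ^ 3 / (6 * π)| ≤ 1 / 6 := by
    rw [abs_div, abs_pow, abs_of_pos (by positivity : (0 : ℝ) < 6 * π), div_le_iff₀ (by positivity)]
    have : |Real.cos (2 * π * t)| ^ 3 ≤ 1 := pow_le_one₀ (abs_nonneg _) hc
    nlinarith
  unfold TorusRough.F
  calc |(-Real.cos (2 * π * t) / (2 * π)) + Real.cos (2 * π * t) ^ 3 / (6 * π)|
      ≤ |(-Real.cos (2 * π * t) / (2 * π))| + |Real.cos (2 * π * t) ^ 3 / (6 * π)| := abs_add_le _ _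
    _ ≤ 1 / 2 + 1 / 6 := add_le_add h2 h3
    _ = 2 / 3 := by norm_num

/-- `F + 1 > 0` everywhere. [folklore] -/
theorem F_add_one_pos (t : ℝ) : 0 < TorusRough.F t + 1 := by
  have h1 := abs_F_le t
  have h2 := neg_abs_le (TorusRough.F t)
  linarith

/-- `|F + 1| ≤ 2`. [folklore] -/
theorem abs_F_add_one_le (t : ℝ) : |TorusRough.F t + 1| ≤ 2 := by
  rw [abs_of_pos (F_add_one_pos t)]
  have h1 := abs_F_le t
  have h2 := le_abs_self (TorusRough.F t)
  linarith

/-- `F(0) = -1/(3π)`. [folklore] -/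
theorem F_zero : TorusRough.F 0 = -(1 / (3 * π)) := by
  unfold TorusRough.F
  rw [mul_zero, Real.cos_zero]
  have hπ : π ≠ 0 := Real.pi_ne_zero
  field_simp
  norm_num

/-- `F(1/2) = 1/(3π)`. [folklore] -/
theorem F_half : TorusRough.F (1 / 2) = 1 / (3 * π) := by
  unfold TorusRough.F
  rw [show 2 * π * (1 / 2) = π by ring, Real.cos_pi]
  have hπ : π ≠ 0 := Real.pi_ne_zero
  field_simp
  norm_num

/-- `F(0) < F(1/2)` (so `F` is not constant). [folklore] -/
theorem F_zero_lt_F_half : TorusRough.F 0 < TorusRough.F (1 / 2) := by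
  rw [F_zero, F_half]
  have : 0 < 1 / (3 * π) := by positivity
  linarith

/-- **The set `{F(t) + 1}` (viewed in `ℂ`) is infinite**: it contains the image of the
non-degenerate interval `[F(0), F(1/2)]` (intermediate value theorem) under the injection
`u ↦ u + 1 : ℝ → ℂ`. [folklore] -/
theorem infinite_range_F_add_one :
    Set.Infinite (range fun t : ℝ ↦ (((TorusRough.F t + 1 : ℝ)) : ℂ)) := by
  have hsub : Icc (TorusRough.F 0) (TorusRough.F (1 / 2)) ⊆ TorusRough.F '' Icc 0 (1 / 2) :=
    intermediate_value_Icc (by norm_num) TorusRough.contDiff_F.continuous.continuousOn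
  have hinf : (Icc (TorusRough.F 0) (TorusRough.F (1 / 2))).Infinite := Icc_infinite F_zero_lt_F_half
  have hinj : InjOn (fun u : ℝ ↦ (((u + 1 : ℝ)) : ℂ)) (Icc (TorusRough.F 0) (TorusRough.F (1 / 2))) := by
    intro u _ v _ huv
    have : (u + 1 : ℝ) = v + 1 := Complex.ofReal_injective huv
    linarith
  refine (hinf.image hinj).mono ?_
  rintro _ ⟨u, hu, rfl⟩
  obtain ⟨t, -, rfl⟩ := hsub hu
  exact ⟨t, rfl⟩

/-! ### The family of coefficients `(F + 1)^{i+1}` and their derivatives `S_i` -/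

/-- `S_i(t) = (i+1) (F(t) + 1)^i sin³(2πt)`, the derivative of `(F + 1)^{i+1}`. [folklore] -/
def Si (i : ℕ) (t : ℝ) : ℝ := (i + 1) * (TorusRough.F t + 1) ^ i * TorusRough.S t

/-- `((F + 1)^{i+1})' = S_i`. [folklore] -/
theorem hasDerivAt_Fpow (i : ℕ) (t : ℝ) :
    HasDerivAt (fun t ↦ (TorusRough.F t + 1) ^ (i + 1)) (Si i t) t := by
  have h := ((TorusRough.hasDerivAt_F t).add_const 1).pow (i + 1)
  refine h.congr_deriv ?_
  simp only [Si, Nat.add_sub_cancel]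
  push_cast
  ring

/-- `S_i` is continuous. [folklore] -/
theorem continuous_Si (i : ℕ) : Continuous (Si i) := by
  have hF : Continuous TorusRough.F := TorusRough.contDiff_F.continuous
  have hS : Continuous TorusRough.S := TorusRough.continuous_S
  unfold Si
  fun_prop

/-- `|S_i| ≤ (i+1) 2^i |sin³(2π ·)|`. [folklore] -/
theorem abs_Si_le (i : ℕ) (t : ℝ) : |Si i t| ≤ (i + 1) * 2 ^ i * |TorusRough.S t| := by
  rw [Si, abs_mul, abs_mul, abs_pow, abs_of_pos (by positivity : (0 : ℝ) < i + 1)]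
  gcongr
  exact abs_F_add_one_le t

/-- At a zero `y₀` of `sin(2π Re ·)`: `|S_i(Re y)| ≤ (i+1) 2^i (2π)² ‖y - y₀‖²` (second-order
vanishing, from `abs_S_re_le`). [folklore] -/
theorem abs_Si_re_le (i : ℕ) {y₀ : ℂ} (h0 : Real.sin (2 * π * y₀.re) = 0) (y : ℂ) :
    |Si i y.re| ≤ (i + 1) * 2 ^ i * ((2 * π) ^ 2 * ‖y - y₀‖ ^ 2) :=
  (abs_Si_le i y.re).trans (mul_le_mul_of_nonneg_left (abs_S_re_le h0 y) (by positivity))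

/-- `S_i(t) ≠ 0` wherever `sin³(2πt) ≠ 0` (`F + 1 > 0`). [folklore] -/
theorem Si_ne_zero (i : ℕ) {t : ℝ} (h : TorusRough.S t ≠ 0) : Si i t ≠ 0 := by
  unfold Si
  exact mul_ne_zero (mul_ne_zero (by positivity) (pow_ne_zero _ (F_add_one_pos t).ne')) h

/-- `y ↦ (F(Re y) + 1)^{i+1}` (complex-valued) has derivative `S_i(Re c) · Re` at `c`. [folklore] -/
theorem hasFDerivAt_Fpow_re (i : ℕ) (c : ℂ) :
    HasFDerivAt (fun y : ℂ ↦ ((((TorusRough.F y.re + 1) ^ (i + 1) : ℝ)) : ℂ))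
      (Complex.ofRealCLM.comp (Si i c.re • Complex.reCLM)) c := by
  have h1 : HasFDerivAt (fun y : ℂ ↦ (TorusRough.F y.re + 1) ^ (i + 1)) (Si i c.re • Complex.reCLM) c :=
    (hasDerivAt_Fpow i c.re).comp_hasFDerivAt c Complex.reCLM.hasFDerivAt
  exact Complex.ofRealCLM.hasFDerivAt.comp c h1

section Charts

attribute [local instance] chartedSpaceT isManifoldT bundle Complex.finrank_real_complex_fact

/-! ### The smooth top-degree forms `α_i = (F(x) + 1)^{i+1} · vol` -/

/-- The coefficient `G_i(q) = (F(x) + 1)^{i+1}` on `T²` (a function of the first coordinate).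
[folklore] -/
def Gi (i : ℕ) (q : T) : ℝ := (TorusRough.Fc q.1 + 1) ^ (i + 1)

/-- `G_i (proj w) = (F (Re w) + 1)^{i+1}`. [folklore] -/
theorem Gi_proj (i : ℕ) (w : ℂ) : Gi i (proj w) = (TorusRough.F w.re + 1) ^ (i + 1) := by
  have h : TorusRough.Fc (proj w).1 = TorusRough.F w.re := TorusRough.Fc_coe _
  rw [Gi, h]

/-- The derivative coefficient `S_i` descended to `T²`:
`Sc_i(q) = (i+1) (Fc(x) + 1)^i Sc(x)`. [folklore] -/
def Sci (i : ℕ) (q : T) : ℝ := (i + 1) * (TorusRough.Fc q.1 + 1) ^ i * TorusRough.Sc q.1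

/-- `Sc_i (proj w) = S_i (Re w)`. [folklore] -/
theorem Sci_proj (i : ℕ) (w : ℂ) : Sci i (proj w) = Si i w.re := by
  have h1 : TorusRough.Fc (proj w).1 = TorusRough.F w.re := TorusRough.Fc_coe _
  have h2 : TorusRough.Sc (proj w).1 = TorusRough.S w.re := TorusRough.Sc_coe _
  rw [Sci, Si, h1, h2]

/-- `S_i` at the canonical lift of `q` is `Sc_i q`. [folklore] -/
theorem Si_lift (i : ℕ) (q : T) : Si i (lift q).re = Sci i q := by
  conv_rhs => rw [← proj_lift q]
  exact (Sci_proj i (lift q)).symm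

/-- The real top-degree form `G_i · vol`. [folklore] -/
def alphaRi (i : ℕ) : MForm 𝓘(ℝ, ℂ) T ℝ 2 := fun q ↦ Gi i q • riemannianVolumeForm orient q

/-- **The form `α_i = (G_i · vol) ⊗ 1`**, a smooth complex `2`-form of type `(1,1)`. [folklore] -/
def alphai (i : ℕ) : MForm 𝓘(ℝ, ℂ) T ℂ 2 := (alphaRi i).ofReal

/-- The chart representatives of `G_i · vol`: `y ↦ (F(Re y) + 1)^{i+1} ε(x₀) det₀`. [folklore] -/
theorem inChart_alphaRi (i : ℕ) (x₀ : T) (y : ℂ) :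
    (alphaRi i).inChart x₀ y = ((TorusRough.F y.re + 1) ^ (i + 1) * sgn x₀) • OriginConjAtlas.det₀ := by
  ext v
  rw [inChart_apply']
  simp only [alphaRi, ContinuousAlternatingMap.smul_apply, smul_eq_mul, Gi_proj, re_L,
    riemannianVolumeForm_apply', OriginConjAtlas.det₀_apply, re_τT, im_τT]
  linear_combination ((TorusRough.F y.re + 1) ^ (i + 1) *
    ((v 0).re * (v 1).im - (v 0).im * (v 1).re)) * sgn_mul_sgn_mul_sgn x₀ (proj (L x₀ y))

/-- `G_i · vol` is smooth. [folklore] -/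
theorem isSmoothForm_alphaRi (i : ℕ) : IsSmoothForm (alphaRi i) := by
  intro x
  rw [funext (inChart_alphaRi i x)]
  have hre : ContDiff ℝ ∞ (fun y : ℂ ↦ y.re) := Complex.reCLM.contDiff
  exact (((((TorusRough.contDiff_F.comp hre).add contDiff_const).pow (i + 1)).mul
    contDiff_const).smul contDiff_const).contDiffWithinAt

/-- **`α_i` is smooth.** [folklore] -/
theorem isSmoothForm_alphai (i : ℕ) : IsSmoothForm (alphai i) := (isSmoothForm_alphaRi i).ofReal

/-- Values of `α_i`: `α_i,x(v, w) = G_i(x) ε(x) det₀(v, w)`. [folklore] -/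
theorem alphai_apply (i : ℕ) (x : T) (v : Fin 2 → TangentSpace 𝓘(ℝ, ℂ) x) :
    alphai i x v = ((Gi i x * (sgn x * (Complex.re (v 0) * Complex.im (v 1) -
      Complex.im (v 0) * Complex.re (v 1))) : ℝ) : ℂ) := by
  rw [alphai, MForm.ofReal_apply]
  simp only [alphaRi, ContinuousAlternatingMap.smul_apply, smul_eq_mul, riemannianVolumeForm_apply']

/-- **`α_i` has type `(1,1)`** (rotations preserve area). [folklore] -/
theorem isOfType_alphai (i : ℕ) : IsOfType 1 1 (alphai i) := by
  refine ⟨rfl, fun x θ v ↦ ?_⟩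
  rw [alphai_apply, alphai_apply]
  simp only [tangentRotate_apply, smul_eq_mul]
  rw [det₀_rotate]
  simp

/-- **`α_i` at `proj t` on the pair `(1, i)`** is `ε (F(t) + 1)^{i+1}`. [folklore] -/
theorem alphai_proj_apply (i : ℕ) (t : ℝ) :
    alphai i (proj (t : ℂ)) (![(1 : ℂ), Complex.I] : Fin 2 → TangentSpace 𝓘(ℝ, ℂ) (proj (t : ℂ))) =
      ((sgn (proj (t : ℂ)) : ℝ) : ℂ) * (((TorusRough.F t + 1 : ℝ)) : ℂ) ^ (i + 1) := by
  rw [alphai_apply, Gi_proj]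
  simp only [Matrix.cons_val_zero, Matrix.cons_val_one, Matrix.cons_val_fin_one, Complex.one_re,
    Complex.I_im, Complex.one_im, Complex.I_re, mul_one, mul_zero, sub_zero, Complex.ofReal_re]
  push_cast
  ring

/-! ### `⋆α_i`, `∂⋆α_i`, and `∂̄*α_i = -⋆∂⋆α_i` in closed form -/

/-- The real `0`-form `G_i`. [folklore] -/
def g0i (i : ℕ) : MForm 𝓘(ℝ, ℂ) T ℝ 0 := fun q ↦ constOfIsEmpty ℝ (TangentSpace 𝓘(ℝ, ℂ) q) (Fin 0) (Gi i q)

/-- `⋆(G_i · vol) = G_i` pointwise (`⋆vol = 1`). [folklore] -/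
theorem hodgeStar_alphaRi (i : ℕ) (h : 1 + 1 + 0 = 2) (q : T) :
    MForm.hodgeStar orient h (alphaRi i) q = g0i i q := by
  rw [MForm.hodgeStar_apply]
  change hodgeStar (orient q) h ((Gi i q) • (orient q).volumeFormL) = _
  rw [map_smul, hodgeStar_volumeFormL_holds (orient q) h]
  ext v
  simp [g0i]

/-- **`⋆α_i = G_i ⊗ 1`.** [folklore] -/
theorem cHodgeStar_alphai (i : ℕ) (h : 1 + 1 + 0 = 2) :
    MForm.cHodgeStar orient h (alphai i) = (g0i i).ofReal := by
  rw [alphai, MForm.cHodgeStar_ofReal]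
  exact congrArg MForm.ofReal (funext (hodgeStar_alphaRi i h))

/-- The chart representatives of `G_i ⊗ 1` are `y ↦ (F(Re y) + 1)^{i+1}` (in every chart). [folklore] -/
theorem inChart_g0i_ofReal (i : ℕ) (x₀ : T) (y : ℂ) :
    (g0i i).ofReal.inChart x₀ y =
      constOfIsEmpty ℝ ℂ (Fin 0) ((((TorusRough.F y.re + 1) ^ (i + 1) : ℝ)) : ℂ) := by
  ext v
  rw [inChart_apply', MForm.ofReal_apply]
  simp [g0i, Gi_proj]

/-- **`d(G_i ⊗ 1) = Sc_i(x) dx`**: the manifold derivative of the `0`-form `G_i` on `v` is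
`Sc_i(q) Re v` (an honest derivative). [folklore] -/
theorem mextDeriv_g0i_ofReal_apply (i : ℕ) (q : T) (v : Fin 1 → TangentSpace 𝓘(ℝ, ℂ) q) :
    mextDeriv (g0i i).ofReal q v = ((Sci i q * Complex.re (v 0) : ℝ) : ℂ) := by
  rw [mextDeriv_eq_extDerivWithin, funext (inChart_g0i_ofReal i q),
    ModelWithCorners.Boundaryless.range_eq_univ, extDerivWithin_univ, extDeriv_constOfIsEmpty,
    (hasFDerivAt_Fpow_re i _).fderiv, ← Si_lift, re_lift]
  rfl

/-- Half of `Sc_i`: the common coefficient of `dz` and `dz̄` in `d(G_i ⊗ 1)`. [folklore] -/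
def a2i (i : ℕ) (q : T) : ℝ := Sci i q / 2

/-- `d(G_i ⊗ 1) = a dz + a dz̄`, `a = Sc_i/2`. [folklore] -/
theorem mextDeriv_g0i_ofReal_eq (i : ℕ) :
    mextDeriv (g0i i).ofReal =
      (fun q ↦ ((a2i i q : ℝ) : ℂ) • dz q) + fun q ↦ ((a2i i q : ℝ) : ℂ) • dzbar q := by
  funext q; ext v
  rw [mextDeriv_g0i_ofReal_apply]
  simp only [a2i, Pi.add_apply, ContinuousAlternatingMap.add_apply, ContinuousAlternatingMap.smul_apply,
    dz_apply, dzbar_apply, smul_eq_mul]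
  apply Complex.ext
  · simp only [Complex.ofReal_re, Complex.add_re, Complex.mul_re, Complex.ofReal_im, zero_mul,
      sub_zero, Complex.conj_re]
    ring
  · simp only [Complex.ofReal_im, Complex.add_im, Complex.mul_im, Complex.ofReal_re, zero_mul,
      add_zero, Complex.conj_im]
    ring

/-- **`∂(⋆α_i) = a dz`**, `a = Sc_i/2`. [folklore] -/
theorem dolbeault_g0i_ofReal (i : ℕ) :
    dolbeault (g0i i).ofReal = fun q ↦ ((a2i i q : ℝ) : ℂ) • dz q := by
  rw [dolbeault, Finset.Nat.antidiagonal_zero, Finset.sum_singleton,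
    (isOfType_zero_zero _).typeComponent_eq_self, mextDeriv_g0i_ofReal_eq, MForm.typeComponent_add,
    (isOfType_smul_dz _).typeComponent_eq_self,
    IsOfType.typeComponent_of_ne_holds (isOfType_smul_dzbar _) (Or.inl (by norm_num)), add_zero]

/-- The real coefficient `b_i(q) = ε(q) Sc_i(q) / 2` of `∂̄*α_i = i b_i dz`. [folklore] -/
def bRi (i : ℕ) (q : T) : ℝ := sgn q * Sci i q / 2

/-- **The form `β_i = i b_i dz`** (which is `∂̄*α_i`, `dolbeaultBarAdjoint_alphai`). [folklore] -/
def betai (i : ℕ) : MForm 𝓘(ℝ, ℂ) T ℂ 1 := fun q ↦ (((bRi i q : ℝ) : ℂ) * Complex.I) • dz q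

/-- **`∂̄*α_i = β_i`**: `∂̄*α_i = -⋆∂⋆α_i = -⋆(a dz) = i ε a dz`. [folklore] -/
theorem dolbeaultBarAdjoint_alphai (i : ℕ) (h : 1 + 1 + 0 = 2) :
    dolbeaultBarAdjoint orient h (alphai i) = betai i := by
  rw [dolbeaultBarAdjoint, cHodgeStar_alphai i h, dolbeault_g0i_ofReal, cHodgeStar_smul_dz]
  funext q; ext v
  simp only [betai, bRi, a2i, Pi.neg_apply, ContinuousAlternatingMap.neg_apply,
    ContinuousAlternatingMap.smul_apply, smul_eq_mul, dz_apply]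
  push_cast
  ring

/-- `β_i` has type `(1,0)`. [folklore] -/
theorem isOfType_betai (i : ℕ) : IsOfType 1 0 (betai i) := isOfType_smul_dz _

/-! ### The junk analysis: `dβ_i = 0` everywhere -/

/-- **The chart representative of `β_i` evaluated on `1`** is the scalar
`y ↦ i ρ(Re y) S_i(Re y) / 2`, which jumps wherever `S_i ≠ 0`. [folklore] -/
theorem inChart_betai_apply_one (i : ℕ) (x₀ : T) (y : ℂ) :
    (betai i).inChart x₀ y ![(1 : ℂ)] = ((ρ y.re * Si i y.re / 2 : ℝ) : ℂ) * Complex.I := by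
  rw [inChart_apply']
  simp only [betai, bRi, ContinuousAlternatingMap.smul_apply, smul_eq_mul, dz_apply, Sci_proj, re_L,
    sgn_proj, Matrix.cons_val_zero]
  have h1 : @Eq ℂ (τT x₀ (proj (L x₀ y)) 1) 1 := by
    apply Complex.ext
    · rw [re_τT, Complex.one_re]
    · rw [im_τT, Complex.one_im, mul_zero]
  rw [h1, mul_one]

/-- **Norm of the chart representative of `β_i`**: `‖β_i.inChart x₀ y‖ ≤ |S_i(Re y)| / 2`. [folklore] -/
theorem norm_inChart_betai_le (i : ℕ) (x₀ : T) (y : ℂ) :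
    ‖(betai i).inChart x₀ y‖ ≤ |Si i y.re| / 2 := by
  refine ContinuousAlternatingMap.opNorm_le_bound _ (by positivity) fun v ↦ ?_
  rw [inChart_apply', Fin.prod_univ_one]
  simp only [betai, bRi, ContinuousAlternatingMap.smul_apply, smul_eq_mul, dz_apply, Sci_proj, re_L]
  rw [norm_mul, norm_mul, Complex.norm_I, mul_one, norm_τT, Complex.norm_real, Real.norm_eq_abs,
    abs_div, abs_mul, abs_sgn, one_mul, abs_two]

/-- At a zero of `sin(2π Re ·)` the representative of `β_i` is differentiable with derivative `0`
(it vanishes to second order). [folklore] -/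
theorem hasFDerivAt_inChart_betai (i : ℕ) {x₀ : T} {y₀ : ℂ} (h0 : Real.sin (2 * π * y₀.re) = 0) :
    HasFDerivAt ((betai i).inChart x₀) (0 : ℂ →L[ℝ] ℂ [⋀^Fin 1]→L[ℝ] ℂ) y₀ := by
  have hb0 : (betai i).inChart x₀ y₀ = 0 := by
    have h1 := norm_inChart_betai_le i x₀ y₀
    have hS : Si i y₀.re = 0 := by simp [Si, TorusRough.S, h0]
    rw [hS, abs_zero, zero_div] at h1
    exact norm_le_zero_iff.1 h1
  rw [hasFDerivAt_iff_isLittleO_nhds_zero]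
  simp only [hb0, sub_zero, _root_.zero_apply]
  have hO : (fun h : ℂ ↦ (betai i).inChart x₀ (y₀ + h)) =O[𝓝 0] fun h : ℂ ↦ ‖h - 0‖ ^ 2 := by
    refine Asymptotics.IsBigO.of_bound ((i + 1) * 2 ^ i * (2 * π) ^ 2 / 2)
      (Filter.Eventually.of_forall fun h ↦ ?_)
    rw [sub_zero, Real.norm_of_nonneg (by positivity)]
    have h1 := norm_inChart_betai_le i x₀ (y₀ + h)
    have h2 := abs_Si_re_le i h0 (y₀ + h)
    rw [add_sub_cancel_left] at h2
    nlinarith [norm_nonneg h, h1, h2]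
  have hlo : (fun h : ℂ ↦ ‖h - 0‖ ^ 2) =o[𝓝 0] fun h : ℂ ↦ h :=
    (Asymptotics.isLittleO_pow_sub_sub (0 : ℂ) one_lt_two).congr_right fun h ↦ sub_zero h
  exact hO.trans_isLittleO hlo

/-- Where `sin³(2π Re y) ≠ 0` the representative of `β_i` is not continuous, hence not
differentiable (its value on `1` is `i ρ S_i / 2` with `S_i ≠ 0` nearby, and `ρ` jumps on every
interval). [folklore] -/
theorem not_differentiableAt_inChart_betai (i : ℕ) {x₀ : T} {y : ℂ} (hy : TorusRough.S y.re ≠ 0) :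
    ¬ DifferentiableAt ℝ ((betai i).inChart x₀) y := by
  intro hd
  have hc : ContinuousAt (fun y ↦ (betai i).inChart x₀ y ![(1 : ℂ)]) y :=
    ((ContinuousAlternatingMap.apply ℝ ℂ ℂ ![(1 : ℂ)]).continuous.continuousAt).comp hd.continuousAt
  simp only [inChart_betai_apply_one] at hc
  -- restrict to the horizontal line through `y`
  have hline : Continuous fun t : ℝ ↦ ((t : ℝ) : ℂ) + ((y.im : ℝ) : ℂ) * Complex.I := by fun_prop
  have hy' : ((y.re : ℝ) : ℂ) + ((y.im : ℝ) : ℂ) * Complex.I = y := Complex.re_add_im y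
  have h1 : ContinuousAt (fun t : ℝ ↦ ((ρ t * Si i t / 2 : ℝ) : ℂ) * Complex.I) y.re := by
    have := hc.comp_of_eq hline.continuousAt hy'
    simpa [Function.comp_def] using this
  have h2 : ContinuousAt (fun t : ℝ ↦ ρ t * Si i t / 2) y.re := by
    have := Complex.continuous_im.continuousAt.comp h1
    simpa [Function.comp_def] using this
  have hSi : Si i y.re ≠ 0 := Si_ne_zero i hy
  have h3 : ContinuousAt (fun t : ℝ ↦ (ρ t * Si i t / 2) / (Si i t / 2)) y.re :=
    h2.div ((continuous_Si i).div_const _).continuousAt (div_ne_zero hSi two_ne_zero)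
  have h4 : (fun t : ℝ ↦ (ρ t * Si i t / 2) / (Si i t / 2)) =ᶠ[𝓝 y.re] ρ := by
    have hne : ∀ᶠ t in 𝓝 y.re, Si i t ≠ 0 := (continuous_Si i).continuousAt.eventually_ne hSi
    filter_upwards [hne] with t ht
    field_simp
  exact not_continuousAt_ρ y.re (h3.congr h4)

/-- **`fderiv (β_i.inChart x₀) = 0` everywhere**: a junk zero where `sin(2π Re y) ≠ 0` (no
continuity), a genuine zero where `sin(2π Re y) = 0` (second-order vanishing). [folklore] -/
theorem fderiv_inChart_betai (i : ℕ) (x₀ : T) (y : ℂ) : fderiv ℝ ((betai i).inChart x₀) y = 0 := by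
  by_cases hS : Real.sin (2 * π * y.re) = 0
  · exact (hasFDerivAt_inChart_betai i hS).fderiv
  · exact fderiv_zero_of_not_differentiableAt
      (not_differentiableAt_inChart_betai i (pow_ne_zero 3 hS))

/-- **`dβ_i = 0`** at every point of the rigged torus. [folklore] -/
theorem mextDeriv_betai (i : ℕ) : mextDeriv (betai i) = 0 := by
  funext x
  exact mextDeriv_apply_eq_zero (by
    rw [ModelWithCorners.Boundaryless.range_eq_univ, fderivWithin_univ]
    exact fderiv_inChart_betai i x _)

/-- **`∂̄β_i = 0`**: `β_i` has pure type `(1,0)` and `dβ_i = 0`. [folklore] -/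
theorem dolbeaultBar_betai (i : ℕ) : dolbeaultBar (betai i) = 0 := by
  rw [dolbeaultBar, Finset.Nat.sum_antidiagonal_eq_sum_range_succ_mk, Finset.sum_range_succ,
    Finset.sum_range_succ, Finset.sum_range_zero, zero_add]
  rw [IsOfType.typeComponent_of_ne_holds (isOfType_betai i) (Or.inl (by norm_num)), mextDeriv_zero,
    MForm.typeComponent_zero, zero_add, (isOfType_betai i).typeComponent_eq_self, mextDeriv_betai,
    MForm.typeComponent_zero]

/-! ### Each `α_i` is `∂̄`-harmonic of type `(1,1)` -/

/-- **`Δ_∂̄ α_i = 0`**: in top degree `Δ_∂̄ = ∂̄∂̄*`, and `∂̄(∂̄*α_i) = ∂̄β_i = 0` (degree `k = 2`,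
`m = 0`, as the fact under refutation instantiates it). [folklore] -/
theorem dolbeaultLaplacian_alphai (i : ℕ) (h : 2 + 0 = 2) :
    dolbeaultLaplacian orient 2 0 h (alphai i) = 0 := by
  simp only [dolbeaultLaplacian]
  rw [dolbeaultBarAdjoint_alphai, dolbeaultBar_betai]

/-- **`α_i` is `∂̄`-harmonic of type `(1,1)`** on the rigged torus. [folklore] -/
theorem isDolbeaultHarmonic_alphai (i : ℕ) (h : 2 + 0 = 2) : IsDolbeaultHarmonic orient 1 1 h (alphai i) :=
  ⟨isSmoothForm_alphai i, isOfType_alphai i, dolbeaultLaplacian_alphai i h⟩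

/-! ### The family `α_i` is linearly independent over `ℂ` -/

/-- **The forms `α_i`, `i ∈ ℕ`, are linearly independent over `ℂ`**: evaluating a vanishing finite
combination `∑ c_i α_i = 0` at `proj t` on `(1, i)` gives `∑ c_i (F(t) + 1)^{i+1} = 0` for all real
`t`, so the polynomial `∑ c_i X^{i+1}` has infinitely many roots and vanishes. [folklore] -/
theorem linearIndependent_alphai : LinearIndependent ℂ alphai := by
  rw [linearIndependent_iff']
  intro s g hsum j hj
  -- evaluate the relation at `proj t` on the pair `(1, i)`
  have heval : ∀ t : ℝ, ∑ i ∈ s, g i * (((TorusRough.F t + 1 : ℝ)) : ℂ) ^ (i + 1) = 0 := by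
    intro t
    have key : ∀ i, (g i • alphai i) (proj (t : ℂ))
        (![(1 : ℂ), Complex.I] : Fin 2 → TangentSpace 𝓘(ℝ, ℂ) (proj (t : ℂ))) =
          g i * (((sgn (proj (t : ℂ)) : ℝ) : ℂ) * (((TorusRough.F t + 1 : ℝ)) : ℂ) ^ (i + 1)) :=
      fun i ↦ by
        rw [Pi.smul_apply, ContinuousAlternatingMap.smul_apply, alphai_proj_apply, smul_eq_mul]
    have h := congrArg (fun γ : MForm 𝓘(ℝ, ℂ) T ℂ 2 ↦
      γ (proj (t : ℂ)) (![(1 : ℂ), Complex.I] : Fin 2 → TangentSpace 𝓘(ℝ, ℂ) (proj (t : ℂ)))) hsum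
    simp only [Finset.sum_apply, ContinuousAlternatingMap.sum_apply, key, Pi.zero_apply,
      ContinuousAlternatingMap.coe_zero] at h
    have hsgn : ((sgn (proj (t : ℂ)) : ℝ) : ℂ) ≠ 0 := Complex.ofReal_ne_zero.2 (sgn_ne_zero _)
    have hswap : ∑ i ∈ s, ((sgn (proj (t : ℂ)) : ℝ) : ℂ) * (g i * (((TorusRough.F t + 1 : ℝ)) : ℂ) ^ (i + 1)) =
        ∑ i ∈ s, g i * (((sgn (proj (t : ℂ)) : ℝ) : ℂ) * (((TorusRough.F t + 1 : ℝ)) : ℂ) ^ (i + 1)) :=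
      Finset.sum_congr rfl fun i _ ↦ by ring
    have h' : ((sgn (proj (t : ℂ)) : ℝ) : ℂ) *
        ∑ i ∈ s, g i * (((TorusRough.F t + 1 : ℝ)) : ℂ) ^ (i + 1) = 0 := by
      rw [Finset.mul_sum, hswap, h]
    exact (mul_eq_zero.1 h').resolve_left hsgn
  -- the polynomial `∑ g_i X^{i+1}` vanishes on the infinite set `F(ℝ) + 1`
  set P : ℂ[X] := ∑ i ∈ s, Polynomial.C (g i) * Polynomial.X ^ (i + 1) with hP
  have hPeval : ∀ z : ℂ, P.eval z = ∑ i ∈ s, g i * z ^ (i + 1) := by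
    intro z
    simp [hP, Polynomial.eval_finsetSum]
  have hroots : range (fun t : ℝ ↦ (((TorusRough.F t + 1 : ℝ)) : ℂ)) ⊆ {z | P.IsRoot z} := by
    rintro _ ⟨t, rfl⟩
    simp only [Set.mem_setOf_eq, Polynomial.IsRoot.def, hPeval, heval]
  have hP0 : P = 0 := Polynomial.eq_zero_of_infinite_isRoot P (infinite_range_F_add_one.mono hroots)
  have hcoeff : P.coeff (j + 1) = g j := by
    simp only [hP, Polynomial.finsetSum_coeff, Polynomial.coeff_C_mul_X_pow, add_left_inj]
    rw [Finset.sum_ite_eq, if_pos hj]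
  rw [← hcoeff, hP0, Polynomial.coeff_zero]

/-! ### Assembly -/

/-- **The named fact `finite_dolbeaultHarmonicForms` is false for the rigged torus** (`E = ℂ`,
`n = 2`, degree `k = 2`, `m = 0`, type `(1,1)`, the flat `C^∞` metric `metric`, which is Hermitian,
and the orientation family `orient`, whose volume form is smooth): the `∂̄`-harmonic `(1,1)`-forms
`α_i = ((F(x) + 1)^{i+1} vol) ⊗ 1`, `i ∈ ℕ`, form an infinite linearly independent family in
`ℋ^{1,1} = dolbeaultHarmonicForms orient 1 1 h`, which is therefore not finite-dimensional.
[folklore] -/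
theorem not_finite_dolbeaultHarmonicForms_torus :
    ¬ finite_dolbeaultHarmonicForms (k := 2) (m := 0) metric orient := by
  intro H
  have h2 : (2 + 0 : ℕ) = 2 := rfl
  haveI : Module.Finite ℂ ↥(dolbeaultHarmonicForms orient 1 1 h2) :=
    H isHermitian h2 isSmoothForm_riemannianVolumeForm
  have hv : LinearIndependent ℂ (fun i : ℕ ↦
      (⟨alphai i, (isDolbeaultHarmonic_alphai i h2).mem_dolbeaultHarmonicForms⟩ :
        ↥(dolbeaultHarmonicForms orient 1 1 h2))) :=
    LinearIndependent.of_comp (dolbeaultHarmonicForms orient 1 1 h2).subtype linearIndependent_alphai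
  exact Module.Finite.not_linearIndependent_of_infinite _ hv

end Charts

end TorusConjAtlas

section UniversalClosure

attribute [local instance] TorusConjAtlas.chartedSpaceT TorusConjAtlas.isManifoldT
  Complex.finrank_real_complex_fact

/-- **`finite_dolbeaultHarmonicForms` fails already over compact real `C^∞` surfaces charted in `ℂ`**
(smooth metric, any orientation family), in degree `k = 2`, `m = 0`: witness the rigged torus
`TorusConjAtlas.T` with the flat metric (`TorusConjAtlas.not_finite_dolbeaultHarmonicForms_torus`).
The intended statement is Voisin (2002), Cor. 5.20 / Thm. 5.22 / Cor. 5.25, for compact complex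
manifolds. [folklore] -/
theorem not_forall_finite_dolbeaultHarmonicForms :
    ¬ ∀ (M : Type) [TopologicalSpace M] [ChartedSpace ℂ M] [IsManifold 𝓘(ℝ, ℂ) ∞ M]
        (g : ContMDiffRiemannianMetric 𝓘(ℝ, ℂ) ∞ ℂ (fun x : M ↦ TangentSpace 𝓘(ℝ, ℂ) x))
        (o : (x : M) → Orientation ℝ (TangentSpace 𝓘(ℝ, ℂ) x) (Fin 2)),
        finite_dolbeaultHarmonicForms (k := 2) (m := 0) g o :=
  fun H ↦ TorusConjAtlas.not_finite_dolbeaultHarmonicForms_torus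
    (H TorusConjAtlas.T TorusConjAtlas.metric TorusConjAtlas.orient)

/-- **The named fact `finite_dolbeaultHarmonicForms` is false as stated.** Closed universally over
exactly the binders it elaborates with — a finite-dimensional complex normed space `E` with
`finrank ℝ E = n`, a charted space `M` over `E` that is a *real* `C^∞` manifold (no
`[IsManifold 𝓘(ℂ, E) ω M]`: the section instance is not mentioned in the body of the `def` and
was therefore not abstracted), degrees `k`, `m`, a `C^∞` Riemannian metric `g` and an orientation
family `o` — the statement fails: witness `E = ℂ`, `n = 2`, `k = 2`, `m = 0`, the compact Hausdorff
torus `(ℝ/ℤ)²` with the `{id, conj}`-rigged real-analytic atlas `TorusConjAtlas.chartedSpaceT`, the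
flat (Hermitian) metric and the orientation `TorusConjAtlas.orient`, for which `ℋ^{1,1}` is
infinite-dimensional (`TorusConjAtlas.not_finite_dolbeaultHarmonicForms_torus`). Hence no closed
proof `finite_dolbeaultHarmonicForms_holds` can exist. The intended statement — Voisin (2002),
Cor. 5.20, Thm. 5.22, Cor. 5.25 (b); Huybrechts (2005), §3.2 — carries the complex-manifold
hypothesis; it is the corrected named fact `finite_dolbeaultHarmonicForms_of_isManifold`
(`KaehlerHodgeComplexAtlasFact.lean`), not discharged (elliptic theory). [folklore] -/
theorem not_finite_dolbeaultHarmonicForms :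
    ¬ ∀ {E : Type} [NormedAddCommGroup E] [NormedSpace ℂ E] {M : Type} [TopologicalSpace M]
        [ChartedSpace E M] {k m : ℕ} [FiniteDimensional ℂ E] {n : ℕ} [Fact (finrank ℝ E = n)]
        [IsManifold 𝓘(ℝ, E) ∞ M]
        (g : ContMDiffRiemannianMetric 𝓘(ℝ, E) ∞ E (fun x : M ↦ TangentSpace 𝓘(ℝ, E) x))
        (o : (x : M) → Orientation ℝ (TangentSpace 𝓘(ℝ, E) x) (Fin n)),
        finite_dolbeaultHarmonicForms (k := k) (m := m) g o :=
  fun H ↦ not_forall_finite_dolbeaultHarmonicForms fun M _ _ _ g o ↦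
    @H ℂ _ _ M _ _ 2 0 _ 2 Complex.finrank_real_complex_fact _ g o

end UniversalClosure

end Literature.NumberTheory.Transcendental
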